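import Summits.QuantumFields.YangMills.Theses.SourcedPressureJensen
import Summits.QuantumFields.YangMills.Theorems.SourcedPressureJensenSourcedPressureDecouplingDefs
import Summits.QuantumFields.YangMills.Theorems.SourcedPressureJensenSourcedPressureDecouplingTorusMeanBound
import Literature.MathematicalPhysics.QuantumFieldTheory.Sweep1
import Literature.MathematicalPhysics.QuantumLattice.LatticeGaugeDLR

/-!
# Skeleton (lead ym-line-spj-p2, line «entropic-seam» RESHAPED as «exact-seam») for
# `SourcedPressureJensen.SourcedPressureDecoupling` (KS2″, stmt-QuantumFields-24296, route rev 9)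

The objects are those of `Theorems/SourcedPressureJensenSourcedPressureDecouplingDefs.lean` (planner ym-idea-3 g2, VERBATIM:
`mT`, `incrT`, `freeCell`, `seamMoment`, `intCard`, `cellCount`; torus of side `L+1` tiled by `q⁴` cells of side `s = ℓ+1`,
`q = (L+1)/(ℓ+1)`, the rest = slabs).

RESHAPING (refuter spj-k1's reduction, endorsed): the seam term is NOT estimated by Brascamp–Lieb / small-field events.  It is the
EXACT free-energy difference `E_T e^{βS_seam} = Z_free(B_s)^{q⁴}/Z_T` (Haar independence of edge-disjoint cells), so
`seamMoment_L → F(B_s, β) − f(β)` as `L → ∞` (`F(B_s,β)` = Sweep1's `freeEnergyPerSite` of the free cube of `s⁴` sites, `f` = the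
torus `freeEnergyDensity`), and `F(B_s, β) − f(β) ≤ β^{−κ₁}` for `s ∈ [β^θ, 4β^θ]`, `θ ≤ θ₀ = 1/64 < a_U(4) = 1/30`, from the tree's
mechanised Chatterjee §17: the windowed one-box upper bound (Lemma 17.2 at the scale `s ≤ β^{a_U}`) against the torus lower rate
(`FreeEnergyRate.stub_lowerRate` + boundary-condition independence).  The scale ceiling `θ₀` is used ONLY to keep the cell inside
the one-box regime of Lemma 17.2.  The crude slack bound on the free-cell increment is likewise a free-energy difference
(`F(B_s, β(1−u)) − F(B_s, β)`, `u = 4hW`).  `stub_window` of the planner's skeleton is the tree theorem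
`SourcedPressureJensen.abs_torusMean_plaqCost_le` (w3 g2) and is no longer a stub.

Stubs (7): `stub_holder` (Hölder over torus translates + convexity in the source strength), `stub_factor` (seam removal
`e^{−βS_seam} ≤ 1` + Haar independence of the cells + torus translation invariance), `stub_seamLimit` (the exact seam identity and
its `L → ∞` limit), `stub_seamFE` (windowed free-energy comparison, HARDEST, lead), `stub_crudeId` (pointwise
`−t(βc−m)(βc′−m) ≤ tW(βc+βc′)` + the free-cell bridge), `stub_crudeFE` (windowed two-coupling free-energy difference, lead),
`stub_count` (tiling combinatorics, planner's, verbatim).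

RECORD-label rung R2xi-G (`WeakCouplingRates.XiPow` = an UPPER bound on the lattice rate); the Yang–Mills mass gap is NOT proved by
anything here.
-/

namespace Summit.QuantumFields.YangMills.Cruxes.SourcedPressureDecoupling.EntropicSeam

open Literature.MathematicalPhysics.QuantumFieldTheory Literature.MathematicalPhysics.QuantumLattice
  Literature.Probability.LatticeModels Summit.QuantumFields.YangMills.Theorems.WeakCouplingRates

/-- STUB `stub_holder` (S/M).  Translation-averaged Hölder (tree: `SourcedPressureJensen.translationAveraged_jensen` with
`P` = the interior-pair set of the tiling, `|P| = intCard`, `c = −h`) followed by convexity of `t ↦ log E_T e^{tΦ}` at `0`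
(`log E e^{λΦ} ≤ λ log E e^{Φ}`, `λ = (L+1)⁴/(2·intCard) ≤ 1`; tree: `log_wilsonExpectation_exp_sum_mul_le` with the two
potentials `Φ`, `0`).  Registered statement (name-keyed alias). -/
abbrev __Registered.stub_holder : Prop :=
  ∀ (G : Type) [Group G] [TopologicalSpace G] [IsTopologicalGroup G] [CompactSpace G], IsCompactSimpleLieGroup G → letI : MeasurableSpace G := borel G; haveI : BorelSpace G := ⟨rfl⟩; ∀ r : LatticeRep G, ∀ β h : ℝ, 0 < h → ∀ n ℓ L : ℕ, 0 < intCard n ℓ L → (L + 1 : ℝ) ^ 4 ≤ 2 * (intCard n ℓ L : ℝ) →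
    incrT r β h n L ≤ ((L + 1 : ℝ) ^ 4 / (2 * (intCard n ℓ L : ℝ))) *
      (((L + 1 : ℝ) ^ 4)⁻¹ * Real.log (wilsonExpectation (L := L + 1) r.ρ β (fun U => Real.exp (-(2 * h) * (∑ x : Fin 4 → Fin (L + 1), if ((∀ k : Fin 4, ((x k : ℕ)) < ((L + 1) / (ℓ + 1)) * (ℓ + 1)) ∧ ((x 1 : ℕ)) % (ℓ + 1) ≠ ℓ ∧ ((x 2 : ℕ)) % (ℓ + 1) ≠ ℓ ∧ ((x 0 : ℕ)) % (ℓ + 1) + n ≤ ℓ) then toTorusObservable (L + 1) (fun V => (β * plaqCost0 (d := 4) r.ρ 1 2 (configShift (fun k => -((x k : ℕ) : ℤ)) V) - mT r β L) * (β * plaqCost0 (d := 4) r.ρ 1 2 (timeShiftLG (G := G) n (configShift (fun k => -((x k : ℕ) : ℤ)) V)) - mT r β L)) U else 0)))))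

/-- STUB `stub_holder` (statement = `__Registered.stub_holder`). -/
theorem stub_holder : __Registered.stub_holder := by
  sorry

/-- STUB `stub_factor` (M/L).  SEAM REMOVAL + CELL INDEPENDENCE: with `X = Π_a X_a`, `X_a = exp(−2h Σ_{pairs inside cell a} H) ≥ 0`
depending only on the edges of cell `a`: `E_T[X] = ∫X e^{−βS_T}dπ/Z_T ≤ ∫Π_a (X_a e^{−βS_a})dπ/Z_T` (`S_T = S_seam + Σ_a S_a`,
`S_seam ≥ 0`, `β > 0`), `= Π_a ∫X_a e^{−βS_a}dπ / Z_T` (product Haar measure `π`: independence of edge-disjoint cells; tree: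
`integral_mul_eq_of_dependsOn_links`-type lemmas / `ProductMeasureTools`), each factor `∫X_a e^{−βS_a}dπ/∫e^{−βS_a}dπ` equals
the cell-`0` ratio `E_T[X_0 e^{βS_out}]/E_T[e^{βS_out}] = exp(s⁴·freeCell(2h))` (torus translation by `s·a`, tree:
`wilsonExpectation_comp_torusConfigShift`), and `Π_a ∫e^{−βS_a}dπ / Z_T = E_T[e^{βS_seam}] = exp(|T|·seamMoment)`.  Hence
`|T|⁻¹ log E_T[X] ≤ (cellCount/|T|)·freeCell(2h) + seamMoment` (`cellCount = q⁴ s⁴`).  Registered statement. -/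
abbrev __Registered.stub_factor : Prop :=
  ∀ (G : Type) [Group G] [TopologicalSpace G] [IsTopologicalGroup G] [CompactSpace G], IsCompactSimpleLieGroup G → letI : MeasurableSpace G := borel G; haveI : BorelSpace G := ⟨rfl⟩; ∀ r : LatticeRep G, ∀ β h : ℝ, 0 < β → 0 < h → ∀ n ℓ L : ℕ, ℓ + 1 ≤ L →
    ((L + 1 : ℝ) ^ 4)⁻¹ * Real.log (wilsonExpectation (L := L + 1) r.ρ β (fun U => Real.exp (-(2 * h) * (∑ x : Fin 4 → Fin (L + 1), if ((∀ k : Fin 4, ((x k : ℕ)) < ((L + 1) / (ℓ + 1)) * (ℓ + 1)) ∧ ((x 1 : ℕ)) % (ℓ + 1) ≠ ℓ ∧ ((x 2 : ℕ)) % (ℓ + 1) ≠ ℓ ∧ ((x 0 : ℕ)) % (ℓ + 1) + n ≤ ℓ) then toTorusObservable (L + 1) (fun V => (β * plaqCost0 (d := 4) r.ρ 1 2 (configShift (fun k => -((x k : ℕ) : ℤ)) V) - mT r β L) * (β * plaqCost0 (d := 4) r.ρ 1 2 (timeShiftLG (G := G) n (configShift (fun k => -((x k : ℕ) : ℤ))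 V)) - mT r β L)) U else 0))))
      ≤ ((cellCount ℓ L : ℝ) / (L + 1 : ℝ) ^ 4) * freeCell r β (2 * h) (mT r β L) n ℓ L + seamMoment r β ℓ L

/-- STUB `stub_factor` (statement = `__Registered.stub_factor`). -/
theorem stub_factor : __Registered.stub_factor := by
  sorry

/-- STUB `stub_seamLimit` (M).  THE EXACT SEAM IDENTITY AND ITS VOLUME LIMIT: `E_T e^{βS_seam} = ∫Π_a e^{−βS_a}dπ/Z_T = Z_zd(B_s)^{q⁴}/Z_T`
(cell independence under the product Haar measure, periodisation `integral_torusLift_eq_integral_zdHaar`, translation invariance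
`FreeEnergy.zdZ_image_shift`; template: `FreeEnergy.abs_torusLogPartition_sub_le`), i.e.
`seamMoment_L = (L+1)⁻⁴ (q⁴ s⁴ · F(B_s, β) − log Z_T)`, and `q⁴s⁴/(L+1)⁴ → 1` (`FreeEnergy.tendsto_div_floor`),
`(L+1)⁻⁴ log Z_T → f(β)` (`exists_hasFreeEnergyDensity_holds`), so `seamMoment_L → F(B_s, β) − f(β)`.  Registered statement. -/
abbrev __Registered.stub_seamLimit : Prop :=
  ∀ (G : Type) [Group G] [TopologicalSpace G] [IsTopologicalGroup G] [CompactSpace G], IsCompactSimpleLieGroup G → letI : MeasurableSpace G := borel G; haveI : BorelSpace G := ⟨rfl⟩; ∀ r : LatticeRep G, ∀ β : ℝ, 0 < β → ∀ ℓ : ℕ,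
    Filter.Tendsto (fun L : ℕ => seamMoment r β ℓ L) Filter.atTop
      (nhds (freeEnergyPerSite r.ρ β (halfOpenBox 4 (ℓ + 1)) - freeEnergyDensity 4 r.ρ β))

/-- STUB `stub_seamLimit` (statement = `__Registered.stub_seamLimit`). -/
theorem stub_seamLimit : __Registered.stub_seamLimit := by
  sorry

/-- STUB `stub_seamFE` (L, HARDEST — lead).  WINDOWED FREE-ENERGY COMPARISON: for `0 < θ ≤ 1/64` there are `κ₁ > 0`, `β₀` with
`F(B_s, β) − f(β) ≤ β^{−κ₁}` whenever `β ≥ β₀` and `β^θ ≤ s ≤ 4β^θ`.  Proof plan (all ingredients in the tree): with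
`B := exists_oneBoxBounds r.ρ` (abstract one-box interface, `B.logZ s β = log Z_zd(B_s)`), `A₀ = 3 log c_H + D·L_M`:
(i) `T(B_s, β) ≤ A₀ + ε_U(β)` for `s ≤ β^{a_U}` (`OneBoxBounds.T_le_G_add`, `rho0_le_half_r₁`, `errU_sq_le`, `abs_Gm_sub_le` — the
body of `FreeEnergyRate.stub_upperRate` WITHOUT the Lemma-17.3 comparison, since the window is already `≤ β^{a_U}`, `a_U = 1/30`);
(ii) `f(β) + (3D/2) log β ≥ A₀ − β^{−κ₂}` (`FreeEnergyRate.stub_lowerRate` + `tendsto_freeEnergyPerSite_halfOpenBox` + `tendsto_coeff`);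
(iii) `F(B_s,β) − f(β) = T(B_s,β) − (coef(s)/2)D log β − f(β) ≤ ε_U + β^{−κ₂} + ((3 − coef s)/2) D log β`, `3 − coef s = 4/s − s⁻⁴ ≤ 4β^{−θ}`.
Registered statement. -/
abbrev __Registered.stub_seamFE : Prop :=
  ∀ (G : Type) [Group G] [TopologicalSpace G] [IsTopologicalGroup G] [CompactSpace G], IsCompactSimpleLieGroup G → letI : MeasurableSpace G := borel G; haveI : BorelSpace G := ⟨rfl⟩; ∀ r : LatticeRep G, ∀ θ : ℝ, 0 < θ → θ ≤ 1 / 64 → ∃ κ₁ β₀ : ℝ, 0 < κ₁ ∧ ∀ β : ℝ, β₀ ≤ β → ∀ ℓ : ℕ, β ^ θ ≤ (ℓ + 1 : ℝ) → (ℓ + 1 : ℝ) ≤ 4 * β ^ θ →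
    freeEnergyPerSite r.ρ β (halfOpenBox 4 (ℓ + 1)) - freeEnergyDensity 4 r.ρ β ≤ β ^ (-κ₁)

/-- STUB `stub_seamFE` (statement = `__Registered.stub_seamFE`). -/
theorem stub_seamFE : __Registered.stub_seamFE := by
  sorry

/-- STUB `stub_crudeId` (M).  CRUDE POINTWISE BOUND + FREE-CELL BRIDGE: for `βc, βc′ ≥ 0`, `|m| ≤ W`, `t ≥ 0`:
`−t(βc − m)(βc′ − m) ≤ tW(βc + βc′)`, and every plaquette of the cell occurs at most twice among the pairs, so the sourced
density is `≤ exp(2tW·β·S_{B_s} ∘ torusLift)`; by the free-cell bridge (`ColdBoxSourcedPressure.Birth.ratio_eq_zdExpect` /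
`integral_exp_cellSource_freeCellState`) and `zdExpect_eq_div_integral`,
`E_free[e^{2tWβ S}] = Z_zd(B_s, β(1−2tW))/Z_zd(B_s, β)`, whence `freeCell(t; m) ≤ F(B_s, β(1−2tW)) − F(B_s, β)`
(`freeEnergyPerSite_halfOpenBox_eq`).  Registered statement. -/
abbrev __Registered.stub_crudeId : Prop :=
  ∀ (G : Type) [Group G] [TopologicalSpace G] [IsTopologicalGroup G] [CompactSpace G], IsCompactSimpleLieGroup G → letI : MeasurableSpace G := borel G; haveI : BorelSpace G := ⟨rfl⟩; ∀ r : LatticeRep G, ∀ β t m W : ℝ, 0 < β → 0 ≤ t → |m| ≤ W → 2 * t * W ≤ 1 → ∀ n ℓ L : ℕ, ℓ + 1 ≤ L →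
    freeCell r β t m n ℓ L ≤ freeEnergyPerSite r.ρ (β * (1 - 2 * t * W)) (halfOpenBox 4 (ℓ + 1)) - freeEnergyPerSite r.ρ β (halfOpenBox 4 (ℓ + 1))

/-- STUB `stub_crudeId` (statement = `__Registered.stub_crudeId`). -/
theorem stub_crudeId : __Registered.stub_crudeId := by
  sorry

/-- STUB `stub_crudeFE` (M/L — lead, shares the package of `stub_seamFE`).  WINDOWED TWO-COUPLING DIFFERENCE: for `0 < θ ≤ 1/64`
there are `C₁, C₂, κ₃ > 0, β₀` with `F(B_s, β(1−u)) − F(B_s, β) ≤ C₁ u + C₂ β^{−κ₃}` for `β ≥ β₀`, `β^θ ≤ s ≤ 4β^θ`, `0 ≤ u ≤ 1/2`: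
upper one-box bound at `β' = β(1−u) ≥ β/2` (as in `stub_seamFE` (i)), lower bound
`F(B_s, β) ≥ ((s+1)/s)⁴ f(β)` (`ChatterjeeFreeEnergy.freeEnergyDensity_le`, Lemma 17.3) with the torus lower rate (ii), and
`(3D/2) log(β/β') ≤ 3D u`.  Registered statement. -/
abbrev __Registered.stub_crudeFE : Prop :=
  ∀ (G : Type) [Group G] [TopologicalSpace G] [IsTopologicalGroup G] [CompactSpace G], IsCompactSimpleLieGroup G → letI : MeasurableSpace G := borel G; haveI : BorelSpace G := ⟨rfl⟩; ∀ r : LatticeRep G, ∀ θ : ℝ, 0 < θ → θ ≤ 1 / 64 → ∃ C₁ C₂ κ₃ β₀ : ℝ, 0 < κ₃ ∧ ∀ β : ℝ, β₀ ≤ β → ∀ ℓ : ℕ, β ^ θ ≤ (ℓ + 1 : ℝ) → (ℓ + 1 : ℝ) ≤ 4 * β ^ θ → ∀ u : ℝ, 0 ≤ u → u ≤ 1 / 2 →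
    freeEnergyPerSite r.ρ (β * (1 - u)) (halfOpenBox 4 (ℓ + 1)) - freeEnergyPerSite r.ρ β (halfOpenBox 4 (ℓ + 1)) ≤ C₁ * u + C₂ * β ^ (-κ₃)

/-- STUB `stub_crudeFE` (statement = `__Registered.stub_crudeFE`). -/
theorem stub_crudeFE : __Registered.stub_crudeFE := by
  sorry

/-- STUB `stub_count` (S, G-free; planner's, verbatim).  Tiling combinatorics: `intCard = q⁴(ℓ+1)·ℓ²·(ℓ+1−n)`,
`cellCount = q⁴(ℓ+1)⁴`, `(L+1)⁴ < (q+1)⁴(ℓ+1)⁴`.  Registered statement. -/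
abbrev __Registered.stub_count : Prop :=
  ∀ n ℓ L : ℕ, 1 ≤ n → 8 * n ≤ ℓ + 1 → 16 * (ℓ + 1) ≤ L + 1 →
    (L + 1 : ℝ) ^ 4 ≤ 2 * (intCard n ℓ L : ℝ) ∧ (intCard n ℓ L : ℝ) ≤ (cellCount ℓ L : ℝ) ∧
      (cellCount ℓ L : ℝ) ≤ (1 + 8 * (n : ℝ) / (ℓ + 1 : ℝ)) * (intCard n ℓ L : ℝ)

/-- STUB `stub_count` (statement = `__Registered.stub_count`). -/
theorem stub_count : __Registered.stub_count := by
  sorry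

/-- The real-arithmetic core of the composition (all analytic objects opaque): from the Hölder step `X ≤ (T4/2I)·Y`, the
factorisation `Y ≤ (Q/T4)·F + S`, the crude slack `F ≤ C₁u + C₂e₃` (`u = 4hW`), the seam bound `S ≤ 2e₁`, the counts
`T4 ≤ 2I`, `Q ≤ (1 + 8ν/s)I` and `ν/s ≤ 2x` (`x = β^{A−θ}`), conclude `X ≤ F/2 + (2 + 16C₁W + 8C₂)eκ + 16C₁W h²`. -/
theorem compose_arith {X Y F S I Q T4 ν s h x e₁ e₃ eκ C₁ C₂ W : ℝ}
    (key1 : X ≤ T4 / (2 * I) * Y) (key2 : Y ≤ Q / T4 * F + S) (key34 : F ≤ C₁ * (2 * (2 * h) * W) + C₂ * e₃)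
    (hsL : S ≤ 2 * e₁) (hcA : T4 ≤ 2 * I) (hcB : I ≤ Q) (hcC : Q ≤ (1 + 8 * ν / s) * I) (hI : 0 < I) (hT : 0 < T4)
    (hnl : ν / s ≤ 2 * x) (hx : 0 ≤ x) (hν : 0 ≤ ν) (hs : 0 < s)
    (he₁0 : 0 ≤ e₁) (he₁ : e₁ ≤ eκ) (hxe : x ≤ eκ) (hx2 : x ^ 2 ≤ eκ) (he₃0 : 0 ≤ e₃) (he₃1 : e₃ ≤ 1)
    (hC₁ : 0 ≤ C₁) (hC₂ : 0 ≤ C₂) (hW : 0 < W) (hh : 0 < h) :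
    X ≤ 1 / 2 * F + (2 + 16 * C₁ * W + 8 * C₂) * eκ + 16 * C₁ * W * h ^ 2 := by
  -- λ = T4/(2I) ∈ (0, 1]
  have hlam0 : 0 < T4 / (2 * I) := by positivity
  have hlam1 : T4 / (2 * I) ≤ 1 := by rw [div_le_one (by positivity)]; linarith
  -- X ≤ (Q/(2I)) F + (T4/(2I)) S
  have hX : X ≤ Q / (2 * I) * F + T4 / (2 * I) * S := by
    have h1 : T4 / (2 * I) * Y ≤ T4 / (2 * I) * (Q / T4 * F + S) := mul_le_mul_of_nonneg_left key2 hlam0.le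
    have e : T4 / (2 * I) * (Q / T4 * F + S) = Q / (2 * I) * F + T4 / (2 * I) * S := by
      field_simp
    linarith [key1, h1, e.le, e.ge]
  -- the seam term: (T4/(2I)) S ≤ 2 e₁
  have hSterm : T4 / (2 * I) * S ≤ 2 * e₁ := by
    rcases le_or_gt 0 S with hS0 | hS0
    · calc T4 / (2 * I) * S ≤ 1 * S := mul_le_mul_of_nonneg_right hlam1 hS0
        _ ≤ 2 * e₁ := by linarith
    · have : T4 / (2 * I) * S ≤ 0 := mul_nonpos_of_nonneg_of_nonpos hlam0.le hS0.le
      linarith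
  -- the crude slack
  have hu0 : 0 ≤ 2 * (2 * h) * W := by positivity
  have h4 : 0 ≤ 4 * ν / s := by positivity
  have hslack0 : 0 ≤ C₁ * (2 * (2 * h) * W) + C₂ * e₃ := by positivity
  have hlamF : Q / (2 * I) * F ≤ 1 / 2 * F + (4 * ν / s) * (C₁ * (2 * (2 * h) * W) + C₂ * e₃) := by
    rcases le_or_gt F 0 with hF0 | hF0
    · have hlam : (1 : ℝ) / 2 ≤ Q / (2 * I) := by
        rw [le_div_iff₀ (by positivity)]; linarith
      have h1 : Q / (2 * I) * F ≤ 1 / 2 * F := mul_le_mul_of_nonpos_right hlam hF0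
      have h2 : 0 ≤ (4 * ν / s) * (C₁ * (2 * (2 * h) * W) + C₂ * e₃) := by positivity
      linarith
    · have hlam2 : Q / (2 * I) ≤ (1 + 8 * ν / s) / 2 := by
        rw [div_le_iff₀ (by positivity)]; linarith
      have h3 := mul_le_mul_of_nonneg_left key34 h4
      calc Q / (2 * I) * F ≤ (1 + 8 * ν / s) / 2 * F := mul_le_mul_of_nonneg_right hlam2 hF0.le
        _ = 1 / 2 * F + (4 * ν / s) * F := by ring
        _ ≤ 1 / 2 * F + (4 * ν / s) * (C₁ * (2 * (2 * h) * W) + C₂ * e₃) := by linarith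
  -- slack term 1: (4ν/s) · C₁ (4 h W) ≤ 16 C₁ W h² + 16 C₁ W eκ
  have e_mid1 : (4 * ν / s) * (C₁ * (2 * (2 * h) * W)) ≤ 16 * C₁ * W * h ^ 2 + 16 * C₁ * W * eκ := by
    have hamgm : h * x ≤ (h ^ 2 + x ^ 2) / 2 := by linarith [sq_nonneg (h - x)]
    have hCW : 0 ≤ C₁ * W := by positivity
    have hCWh : 0 ≤ C₁ * W * h := by positivity
    have step : (4 * ν / s) * (C₁ * (2 * (2 * h) * W)) ≤ 32 * (C₁ * W) * (h * x) := by
      have t := mul_le_mul_of_nonneg_right hnl hCWh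
      calc (4 * ν / s) * (C₁ * (2 * (2 * h) * W)) = 16 * (ν / s * (C₁ * W * h)) := by ring
        _ ≤ 16 * (2 * x * (C₁ * W * h)) := by linarith
        _ = 32 * (C₁ * W) * (h * x) := by ring
    have t1 := mul_le_mul_of_nonneg_left hamgm hCW
    have t2 := mul_le_mul_of_nonneg_left hx2 hCW
    have e : 32 * (C₁ * W) * (h * x) = 32 * ((C₁ * W) * (h * x)) := by ring
    linarith [step, t1, t2]
  -- slack term 2: (4ν/s) · C₂ e₃ ≤ 8 C₂ eκ
  have e_mid2 : (4 * ν / s) * (C₂ * e₃) ≤ 8 * C₂ * eκ := by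
    have s0 : C₂ * e₃ ≤ C₂ := mul_le_of_le_one_right hC₂ he₃1
    have s1 : (4 * ν / s) * (C₂ * e₃) ≤ (8 * x) * (C₂ * e₃) := by
      have : 4 * ν / s ≤ 8 * x := by rw [mul_div_assoc]; linarith
      exact mul_le_mul_of_nonneg_right this (by positivity)
    have s2 : (8 * x) * (C₂ * e₃) ≤ (8 * x) * C₂ := mul_le_mul_of_nonneg_left s0 (by positivity)
    have s3 : (8 * C₂) * x ≤ (8 * C₂) * eκ := mul_le_mul_of_nonneg_left hxe (by positivity)
    linarith
  -- conclude
  have hsplit : (4 * ν / s) * (C₁ * (2 * (2 * h) * W) + C₂ * e₃)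
      = (4 * ν / s) * (C₁ * (2 * (2 * h) * W)) + (4 * ν / s) * (C₂ * e₃) := by ring
  have heκ : (2 + 16 * C₁ * W + 8 * C₂) * eκ = 2 * eκ + 16 * C₁ * W * eκ + 8 * C₂ * eκ := by ring
  linarith [hX, hSterm, hlamF, e_mid1, e_mid2, he₁, hsplit, heκ]

set_option maxHeartbeats 1600000 in
/-- COMPOSITION (kernel-checked, no sorry): the seven stubs imply KS2″ `SourcedPressureDecoupling` BY NAME.
Constants: `θ₀ = 1/64`; `W = max W₀ 1` (`W₀` from `abs_torusMean_plaqCost_le`); `κ′ = min κ₁ (θ−A)`;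
`C′ = 2 + 16 C₁⁺ W + 8 C₂⁺`; `M′ = 16 C₁⁺ W`; `h₁ = 1/(8W)`; `ℓ + 1 = ⌈β^θ⌉`; `β₂ ≥ β-thresholds, 2, 16^{1/(θ−A)}`. -/
theorem SourcedPressureDecoupling_of
    (hholder : __Registered.stub_holder)
    (hfactor : __Registered.stub_factor)
    (hseamL : __Registered.stub_seamLimit)
    (hseamFE : __Registered.stub_seamFE)
    (hcrudeI : __Registered.stub_crudeId)
    (hcrudeFE : __Registered.stub_crudeFE)
    (hcount : __Registered.stub_count) :
    Summit.QuantumFields.YangMills.Theses.SourcedPressureJensen.SourcedPressureDecoupling := by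
  intro G _ _ _ _ hG
  letI : MeasurableSpace G := borel G
  haveI : BorelSpace G := ⟨rfl⟩
  intro r
  refine ⟨1 / 64, by norm_num, ?_⟩
  intro θ A hA hAθ hθ0
  have hθ : 0 < θ := hA.trans hAθ
  have hθA : 0 < θ - A := sub_pos.mpr hAθ
  obtain ⟨W₀, βW, Hwin⟩ := Summit.QuantumFields.YangMills.Theorems.SourcedPressureJensen.abs_torusMean_plaqCost_le G hG r
  obtain ⟨κ₁, βS, hκ₁, HseamFE⟩ := hseamFE G hG r θ hθ hθ0
  obtain ⟨C₁, C₂, κ₃, βC, hκ₃, HcrudeFE⟩ := hcrudeFE G hG r θ hθ hθ0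
  obtain ⟨W, hW1, hWW⟩ : ∃ W : ℝ, 1 ≤ W ∧ W₀ ≤ W := ⟨max W₀ 1, le_max_right _ _, le_max_left _ _⟩
  have hW0 : 0 < W := by linarith
  obtain ⟨C₁', hC₁'0, hC₁le⟩ : ∃ C : ℝ, 0 ≤ C ∧ C₁ ≤ C := ⟨max C₁ 0, le_max_right _ _, le_max_left _ _⟩
  obtain ⟨C₂', hC₂'0, hC₂le⟩ : ∃ C : ℝ, 0 ≤ C ∧ C₂ ≤ C := ⟨max C₂ 0, le_max_right _ _, le_max_left _ _⟩
  refine ⟨W, min κ₁ (θ - A), 2 + 16 * C₁' * W + 8 * C₂', 16 * C₁' * W, 1 / (8 * W),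
    max (max (max βW βS) (max βC 2)) ((16 : ℝ) ^ (1 / (θ - A))),
    lt_min hκ₁ hθA, by positivity, ?_⟩
  intro β hβ n hn1 hn2 h hh hh1
  have hβW : βW ≤ β := le_trans (le_trans (le_trans (le_max_left _ _) (le_max_left _ _)) (le_max_left _ _)) hβ
  have hβS : βS ≤ β := le_trans (le_trans (le_trans (le_max_right _ _) (le_max_left _ _)) (le_max_left _ _)) hβ
  have hβC : βC ≤ β := le_trans (le_trans (le_trans (le_max_left _ _) (le_max_right _ _)) (le_max_left _ _)) hβ
  have hβ2 : (2 : ℝ) ≤ β := le_trans (le_trans (le_trans (le_max_right _ _) (le_max_right _ _)) (le_max_left _ _)) hβ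
  have hβs : (16 : ℝ) ^ (1 / (θ - A)) ≤ β := le_trans (le_max_right _ _) hβ
  have hβ1 : (1 : ℝ) ≤ β := by linarith
  have hb0 : 0 < β := by linarith
  have hθpos : 0 < β ^ θ := Real.rpow_pos_of_pos hb0 θ
  have h1θ : 1 ≤ β ^ θ := Real.one_le_rpow hβ1 hθ.le
  -- the cell side ℓ + 1 = ⌈β^θ⌉
  have hc1 : 1 ≤ ⌈β ^ θ⌉₊ := Nat.one_le_iff_ne_zero.mpr (Nat.pos_iff_ne_zero.mp (Nat.ceil_pos.mpr hθpos))
  have hcast : (((⌈β ^ θ⌉₊ - 1 : ℕ) : ℝ) + 1) = (⌈β ^ θ⌉₊ : ℝ) := by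
    rw [Nat.cast_sub hc1]; push_cast; ring
  obtain ⟨ℓ, hℓ1, hℓ2⟩ : ∃ ℓ : ℕ, β ^ θ ≤ (ℓ + 1 : ℝ) ∧ (ℓ + 1 : ℝ) ≤ 4 * β ^ θ := by
    refine ⟨⌈β ^ θ⌉₊ - 1, ?_, ?_⟩
    · rw [hcast]; exact Nat.le_ceil _
    · rw [hcast]; have := Nat.ceil_lt_add_one hθpos.le; linarith
  refine ⟨ℓ, hℓ1, hℓ2, ?_⟩
  have hℓpos : (0 : ℝ) < (ℓ + 1 : ℝ) := by positivity
  -- 16 β^A ≤ β^θ, hence 8 n ≤ ℓ + 1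
  have h16 : 16 * β ^ A ≤ β ^ θ := by
    have h1 : (16 : ℝ) ≤ β ^ (θ - A) := by
      have e : ((16 : ℝ) ^ (1 / (θ - A))) ^ (θ - A) = 16 := by
        rw [← Real.rpow_mul (by norm_num : (0 : ℝ) ≤ 16), one_div_mul_cancel hθA.ne', Real.rpow_one]
      rw [← e]; exact Real.rpow_le_rpow (by positivity) hβs hθA.le
    have h2 : β ^ A * β ^ (θ - A) = β ^ θ := by rw [← Real.rpow_add hb0]; congr 1; ring
    have hApos : 0 < β ^ A := Real.rpow_pos_of_pos hb0 A
    have h3 := mul_le_mul_of_nonneg_left h1 hApos.le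
    linarith
  have h8n : 8 * n ≤ ℓ + 1 := by
    have : (8 * n : ℝ) ≤ (ℓ + 1 : ℝ) := by linarith
    exact_mod_cast this
  -- the seam: eventually `seamMoment < 2 β^(−κ₁)` (exact seam limit + windowed free-energy comparison)
  have hFE := HseamFE β hβS ℓ hℓ1 hℓ2
  have hneg0 : 0 < β ^ (-κ₁) := Real.rpow_pos_of_pos hb0 _
  have hlt : freeEnergyPerSite r.ρ β (halfOpenBox 4 (ℓ + 1)) - freeEnergyDensity 4 r.ρ β < 2 * β ^ (-κ₁) := by
    linarith
  have hevS : ∀ᶠ L : ℕ in Filter.atTop, seamMoment r β ℓ L < 2 * β ^ (-κ₁) :=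
    (hseamL G hG r β hb0 ℓ).eventually_lt_const hlt
  -- eventually in L: room for the tiling
  have hev3 : ∀ᶠ L : ℕ in Filter.atTop, 16 * (ℓ + 1) ≤ L + 1 := by
    filter_upwards [Filter.eventually_ge_atTop (16 * (ℓ + 1))] with L hL
    omega
  filter_upwards [Hwin β hβW, hevS, hev3] with L hmL hsL h16L
  have hmW : |mT r β L| ≤ W := le_trans hmL hWW
  refine ⟨le_trans hmL hWW, ?_⟩
  obtain ⟨hcA, hcB, hcC⟩ := hcount n ℓ L hn1 h8n h16L
  have hℓL : ℓ + 1 ≤ L := by omega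
  have hT : (0 : ℝ) < (L + 1 : ℝ) ^ 4 := by positivity
  have hIposR : (0 : ℝ) < (intCard n ℓ L : ℝ) := by linarith
  have hIpos : 0 < intCard n ℓ L := by exact_mod_cast hIposR
  -- the four analytic inputs at this `L`
  have key1 := hholder G hG r β h hh n ℓ L hIpos hcA
  have key2 := hfactor G hG r β h hb0 hh n ℓ L hℓL
  have h2h : (0 : ℝ) ≤ 2 * h := by linarith
  have hhW : h * W ≤ 1 / 8 := by
    have := hh1
    rw [le_div_iff₀ (by positivity)] at this
    linarith
  have hu1 : 2 * (2 * h) * W ≤ 1 := by linarith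
  have hu0 : 0 ≤ 2 * (2 * h) * W := by positivity
  have hu2 : 2 * (2 * h) * W ≤ 1 / 2 := by linarith
  have key3 := hcrudeI G hG r β (2 * h) (mT r β L) W hb0 h2h hmW hu1 n ℓ L hℓL
  have key4 := HcrudeFE β hβC ℓ hℓ1 hℓ2 (2 * (2 * h) * W) hu0 hu2
  have hβκ₃ : 0 ≤ β ^ (-κ₃) := (Real.rpow_pos_of_pos hb0 _).le
  have key4' : freeEnergyPerSite r.ρ (β * (1 - 2 * (2 * h) * W)) (halfOpenBox 4 (ℓ + 1)) -
      freeEnergyPerSite r.ρ β (halfOpenBox 4 (ℓ + 1)) ≤ C₁' * (2 * (2 * h) * W) + C₂' * β ^ (-κ₃) := by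
    have a1 : C₁ * (2 * (2 * h) * W) ≤ C₁' * (2 * (2 * h) * W) := mul_le_mul_of_nonneg_right hC₁le hu0
    have a2 : C₂ * β ^ (-κ₃) ≤ C₂' * β ^ (-κ₃) := mul_le_mul_of_nonneg_right hC₂le hβκ₃
    linarith
  -- n/(ℓ+1) ≤ 2 β^(A−θ)
  have hx : 0 ≤ β ^ (A - θ) := (Real.rpow_pos_of_pos hb0 _).le
  have hnl : (n : ℝ) / (ℓ + 1 : ℝ) ≤ 2 * β ^ (A - θ) := by
    rw [div_le_iff₀ hℓpos]
    have e : β ^ (A - θ) * β ^ θ = β ^ A := by rw [← Real.rpow_add hb0]; congr 1; ring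
    have t := mul_le_mul_of_nonneg_left hℓ1 hx
    linarith
  -- exponents
  have hk1 : β ^ (-κ₁) ≤ β ^ (-(min κ₁ (θ - A))) :=
    Real.rpow_le_rpow_of_exponent_le hβ1 (neg_le_neg (min_le_left _ _))
  have hk2 : β ^ (-(θ - A)) ≤ β ^ (-(min κ₁ (θ - A))) :=
    Real.rpow_le_rpow_of_exponent_le hβ1 (neg_le_neg (min_le_right _ _))
  have hxe : β ^ (A - θ) ≤ β ^ (-(min κ₁ (θ - A))) := by
    have : β ^ (A - θ) = β ^ (-(θ - A)) := by congr 1; ring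
    rw [this]; exact hk2
  have hx2 : (β ^ (A - θ)) ^ 2 ≤ β ^ (-(min κ₁ (θ - A))) := by
    have hsq : (β ^ (A - θ)) ^ 2 = β ^ (-(2 * (θ - A))) := by
      rw [sq, ← Real.rpow_add hb0]; congr 1; ring
    rw [hsq]; exact le_trans (Real.rpow_le_rpow_of_exponent_le hβ1 (by linarith)) hk2
  have hκ₃1 : β ^ (-κ₃) ≤ 1 := Real.rpow_le_one_of_one_le_of_nonpos hβ1 (by linarith)
  exact compose_arith key1 key2 (key3.trans key4') hsL.le hcA hcB hcC hIposR hT hnl hx (Nat.cast_nonneg n) hℓpos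
    hneg0.le hk1 hxe hx2 hβκ₃ hκ₃1 hC₁'0 hC₂'0 hW0 hh

/-- The line closes KS2″ once the seven stubs are proved. -/
theorem SourcedPressureDecoupling_holds :
    Summit.QuantumFields.YangMills.Theses.SourcedPressureJensen.SourcedPressureDecoupling :=
  SourcedPressureDecoupling_of stub_holder stub_factor stub_seamLimit stub_seamFE stub_crudeId stub_crudeFE stub_count

end Summit.QuantumFields.YangMills.Cruxes.SourcedPressureDecoupling.EntropicSeam
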